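import Literature.AnabelianGeometry.EtaleTheta.Discharge.Sec2KummerTwistTheta
import HarnessLib

/-!
# The KUMMER-TWIST model of `ThetaCovers.TemperedCoverData` ([EtTh] §2, Def. 2.5), part 3: the tempered layer
# `Π^tp_C = A × ℤ ↪ Π_C = A × Ẑ`, `K ⊇ μ_l`, the cusp stabiliser `N(tp D_x) = Π^tp_{C̲}`, and `⁅Δ_X, Δ_X⁆ · Ker = Δ̄_Θ`

S. Mochizuki, *The étale theta function …*, Publ. RIMS **45** (2009) [MochizukiEtTh2009], §2, Def. 2.5 pp.39–40, Cor. 2.9 p.43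
(PDF).  abc-iut cell, seat abc-iut-f-141. CONSISTENCY WITNESS / TOY, PROOF-ONLY (0 definitions), continuation of
`ThetaCoversKummerTwistTemperedDefs.lean` / `Discharge/Sec2KummerTwistTheta.lean`; the tempered dressing (`id_A × η_ℤ`, `quotZ` by
the `ℤ`-projection, `Ÿ`/`Ċ` by the `ℤ/2`-coordinate) is abc-iut-f-142's `Sec2TwistedModelTempered.lean` verbatim for the new finite
factor.  NEW here: `hasMuL_model` (the centre is central), the tempered members `Π^tp_{C̲} = Φ^tp⁻¹((ℤ/l)³ ⋊ {1, s r})`,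
`Π^tp_{X̲}`, `Π^tp_{X̲̲}`, `Π^tp_{C̲̲}`, `Π^tp_X`, `tp D_x` as `Φ^tp`-preimages, **`normalizer_tpDx : N_{Π^tp_C}(tp D_x) = Π^tp_{C̲}`**
(it CONTAINS the inversion `ι̲ = s r` and meets `Π^tp_X` in `Π^tp_{X̲}` — abc-iut-L2-d3's `hC2`, `hC1`), and
**`commutator_sup_barKer : ⁅Δ_X, Δ_X⁆ ⊔ Ker = Δ̄_Θ-preimage`** (abc-iut-L2-d3's `hΘ`). [cite: MochizukiEtTh2009, Def 2.5 p.39]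
-/

noncomputable section

namespace Literature.AnabelianGeometry.EtaleTheta

namespace ThetaCovers

namespace KummerModel

open Multiplicative KummerWitness Literature.AnabelianGeometry.SemiGraphs
  Literature.AnabelianGeometry.EtaleTheta.SettingModel TemperedModel

variable (l : ℕ)

/-! ## 1. Subgroups of `Π^tp_C = A × ℤ` and the embedding `Π^tp_C ↪ Π_C` -/

/-- `A_X` is normal (index `2`). (toy bookkeeping) [cite: MochizukiEtTh2009, Def 2.5 p.39] -/
theorem TKX_normal : (TKX l).Normal := by
  haveI := kumPiX_normal l
  exact Subgroup.Normal.comap inferInstance _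

/-- Pull-backs along `Π^tp_C ↪ Π_C` of `Φ`-preimages are `Φ^tp`-preimages. (toy bookkeeping) [cite: MochizukiEtTh2009, Def 2.5 p.39] -/
theorem comap_toHatK_comap_PhiK (H : Subgroup (kumPiC l)) :
    (H.comap (PhiK l)).comap (toHatK l).toMonoidHom = H.comap (PhiG l) := by
  rw [Subgroup.comap_comap]; rfl

/-- **`Π^tp_X = A_X × ℤ`**: the inverse image of `Π_X ⊆ Π_C` in `Π^tp_C`. (toy bookkeeping) [cite: MochizukiEtTh2009, Def 2.5 p.39] -/
theorem comap_toHatK_PiXK : (PiXK l).comap (toHatK l).toMonoidHom = (TKX l).prod ⊤ := by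
  ext ⟨a, n⟩
  rw [Subgroup.mem_prod]
  change TK.kum l a ∈ kumPiX l ↔ a ∈ TKX l ∧ n ∈ (⊤ : Subgroup (Multiplicative ℤ))
  exact ⟨fun h => ⟨h, trivial⟩, fun h => h.1⟩

/-- Membership in `Π^tp_X = A_X × ℤ`. (toy bookkeeping) [cite: MochizukiEtTh2009, Def 2.5 p.39] -/
theorem mem_comap_toHatK_PiXK (x : GtpK l) : x ∈ (PiXK l).comap (toHatK l).toMonoidHom ↔ x.1 ∈ TKX l := by
  rw [comap_toHatK_PiXK, Subgroup.mem_prod]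
  exact ⟨fun h => h.1, fun h => ⟨h, trivial⟩⟩

/-- **`Π^tp_C ↪ Π_C` is injective** (`η_ℤ` is). (toy bookkeeping) [cite: MochizukiEtTh2009, Def 2.5 p.39] -/
theorem toHatK_injective : Function.Injective (toHatK l) := by
  intro x y h
  have h1 : (toHatK l x).1 = (toHatK l y).1 := congrArg Prod.fst h
  have h2 : (toHatK l x).2 = (toHatK l y).2 := congrArg Prod.snd h
  exact Prod.ext h1 (etaCont_int_injective h2)

variable [NeZero l]

/-- The finite discrete group `A` is its own profinite completion (identity map). (toy bookkeeping) [cite: MochizukiEtTh2009, Def 2.5 p.39] -/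
theorem isProfiniteCompletion_id_TK : IsProfiniteCompletion (ContinuousMonoidHom.id (TK l)) where
  compactSpace := inferInstance
  t2Space := inferInstance
  totallyDisconnectedSpace := inferInstance
  denseRange := denseRange_id
  comap_surjective U _ := ⟨U, by ext; rfl⟩
  isOpen_comap V := V.isOpen'

/-- **`Π^tp_C ↪ Π_C` is a profinite completion** in abc-iut-L3's sense (product of `id_A` and `η_ℤ`). (toy bookkeeping)
[cite: MochizukiEtTh2009, Def 2.5 p.39] -/
theorem isProfiniteCompletion_toHatK : IsProfiniteCompletion (toHatK l) :=
  (isProfiniteCompletion_id_TK l).prodMap (isProfiniteCompletion_of_eta (etaCont (Multiplicative ℤ)) fun _ => rfl)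

omit [NeZero l] in
/-- **`Π^tp_X / Π^tp_Y ≅ ℤ`** for `Π^tp_Y := A_X × {0}` (the Tate quotient `Z`, p.39). (toy bookkeeping) [cite: MochizukiEtTh2009, Def 2.5 p.39] -/
theorem nonempty_quotZ [((TKX l).prod (⊥ : Subgroup (Multiplicative ℤ))).Normal] :
    Nonempty (↥((PiXK l).comap (toHatK l).toMonoidHom) ⧸
      (((TKX l).prod (⊥ : Subgroup (Multiplicative ℤ))).subgroupOf ((PiXK l).comap (toHatK l).toMonoidHom)) ≃*
        Multiplicative ℤ) := by
  let K : Subgroup (GtpK l) := (PiXK l).comap (toHatK l).toMonoidHom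
  let f : ↥K →* Multiplicative ℤ := (MonoidHom.snd _ _).comp (Subgroup.subtype _)
  have hf : Function.Surjective f := fun n =>
    ⟨⟨(1, n), (mem_comap_toHatK_PiXK l _).mpr (TKX l).one_mem⟩, rfl⟩
  have hker : f.ker = ((TKX l).prod (⊥ : Subgroup (Multiplicative ℤ))).subgroupOf K := by
    ext ⟨⟨a, n⟩, ha⟩
    rw [MonoidHom.mem_ker, Subgroup.mem_subgroupOf, Subgroup.mem_prod, Subgroup.mem_bot]
    exact ⟨fun h => ⟨(mem_comap_toHatK_PiXK l _).mp ha, h⟩, fun h => h.2⟩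
  exact ⟨(QuotientGroup.quotientMulEquivOfEq hker.symm).trans (QuotientGroup.quotientKerEquivOfSurjective f hf)⟩

omit [NeZero l] in
/-- **`[Π^tp_Y : Π^tp_Ÿ] = 2`** for `Π^tp_Ÿ := (A_X ∩ Ker two) × {0}` (the `ℤ/2`-coordinate). (toy bookkeeping) [cite: MochizukiEtTh2009, Def 2.5 p.40] -/
theorem relIndex_PiYddtp : (((TKX l ⊓ (TK.two l).ker)).prod (⊥ : Subgroup (Multiplicative ℤ))).relIndex
    ((TKX l).prod ⊥) = 2 := by
  let g : ↥((TKX l).prod (⊥ : Subgroup (Multiplicative ℤ))) →* Multiplicative (ZMod 2) :=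
    (TK.two l).comp ((MonoidHom.fst _ _).comp (Subgroup.subtype _))
  have hg : Function.Surjective g := fun y =>
    ⟨⟨(TK.inK l 1 y, 1), ⟨show TK.kum l (TK.inK l 1 y) ∈ kumPiX l from by
      rw [TK.kum_inK]; exact (kumPiX l).one_mem, rfl⟩⟩, rfl⟩
  have hker : g.ker = (((TKX l ⊓ (TK.two l).ker)).prod (⊥ : Subgroup (Multiplicative ℤ))).subgroupOf
      ((TKX l).prod ⊥) := by
    ext ⟨⟨a, n⟩, ha⟩
    rw [MonoidHom.mem_ker, Subgroup.mem_subgroupOf, Subgroup.mem_prod, Subgroup.mem_inf, MonoidHom.mem_ker]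
    exact ⟨fun h => ⟨⟨ha.1, h⟩, ha.2⟩, fun h => h.1.2⟩
  change ((((TKX l ⊓ (TK.two l).ker)).prod (⊥ : Subgroup (Multiplicative ℤ))).subgroupOf ((TKX l).prod ⊥)).index = 2
  rw [← hker, Subgroup.index_ker, MonoidHom.range_eq_top.mpr hg, Subgroup.card_top, Nat.card_eq_fintype_card,
    Fintype.card_multiplicative, ZMod.card]

omit [NeZero l] in
/-- **`[Π^tp_C : Π^tp_Ċ] = 2`** for `Π^tp_Ċ := Ker(two) × ℤ`. (toy bookkeeping) [cite: MochizukiEtTh2009, Def 2.5 p.39] -/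
theorem index_PiCdot : (((TK.two l).ker).prod (⊤ : Subgroup (Multiplicative ℤ))).index = 2 := by
  have hsurj : Function.Surjective (TK.two l) := fun y => ⟨TK.inK l 1 y, rfl⟩
  rw [Subgroup.index_prod, Subgroup.index_top, mul_one, Subgroup.index_ker, MonoidHom.range_eq_top.mpr hsurj,
    Subgroup.card_top, Nat.card_eq_fintype_card, Fintype.card_multiplicative, ZMod.card]

omit [NeZero l] in
/-- `Π^tp_Ċ ≠ Π^tp_X` (the element `((s r, 1), 0)`). (toy bookkeeping) [cite: MochizukiEtTh2009, Def 2.5 p.39] -/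
theorem PiCdot_ne : ((TK.two l).ker).prod (⊤ : Subgroup (Multiplicative ℤ)) ≠ (PiXK l).comap (toHatK l).toMonoidHom := by
  intro h
  have hw : iotaG l ∈ ((TK.two l).ker).prod (⊤ : Subgroup (Multiplicative ℤ)) := ⟨rfl, trivial⟩
  rw [h, mem_comap_toHatK_PiXK] at hw
  exact iota_not_mem_kumPiX l hw

/-! ## 2. `K ⊇ μ_l` in the model -/

omit [NeZero l] in
/-- **`K ⊇ μ_l` holds in the Kummer-twist model** (`HasMuL`: all of `Π_C` centralises `Δ̄_Θ` modulo `Ker` — indeed the centre is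
central on the nose). (toy bookkeeping) [cite: MochizukiEtTh2009, Cor 2.9 p.43] -/
theorem hasMuL_model (c : PiCK l) {t : PiCK l} (ht : t ∈ barThetaK l) : c * t * c⁻¹ * t⁻¹ ∈ barKerK l := by
  change PhiK l (c * t * c⁻¹ * t⁻¹) = 1
  rw [map_mul, map_mul, map_mul, map_inv, map_inv]
  exact z_central l (PhiK l c) ht

/-! ## 3. The tempered members of the model as `Φ^tp`-preimages -/

omit [NeZero l] in
/-- **`Π^tp_{C̲} = Φ^tp⁻¹((ℤ/l)³ ⋊ {1, s r})`**. (toy bookkeeping) [cite: MochizukiEtTh2009, Def 2.5 p.39] -/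
theorem tp_PiCu : (PiCuuK l ⊔ barThetaK l).comap (toHatK l).toMonoidHom = (kumHp l).comap (PhiG l) := by
  rw [PiCuuK_sup_barThetaK, HpK, comap_toHatK_comap_PhiK]

omit [NeZero l] in
/-- **`Π^tp_{X̲} = Φ^tp⁻¹((ℤ/l)³ ⋊ 1)`**. (toy bookkeeping) [cite: MochizukiEtTh2009, Def 2.5 p.39] -/
theorem tp_PiXu : ((PiCuuK l ⊓ PiXK l) ⊔ barThetaK l).comap (toHatK l).toMonoidHom = (kumH l).comap (PhiG l) := by
  rw [PiXuuK_sup_barThetaK, comap_toHatK_comap_PhiK]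

omit [NeZero l] in
/-- **`Π^tp_{X̲̲} = Φ^tp⁻¹({y = −x} ⋊ 1)`**. (toy bookkeeping) [cite: MochizukiEtTh2009, Def 2.5 p.39] -/
theorem tp_PiXuu : (PiCuuK l ⊓ PiXK l).comap (toHatK l).toMonoidHom = (kumXuu l).comap (PhiG l) := by
  rw [PiCuuK_inf_PiXK, comap_toHatK_comap_PhiK]

omit [NeZero l] in
/-- **`Π^tp_{C̲̲} = Φ^tp⁻¹({y = −x} ⋊ {1, s r})`**. (toy bookkeeping) [cite: MochizukiEtTh2009, Def 2.5 p.39] -/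
theorem tp_PiCuu : (PiCuuK l).comap (toHatK l).toMonoidHom = (kumCuu l).comap (PhiG l) :=
  comap_toHatK_comap_PhiK l _

omit [NeZero l] in
/-- **`Π^tp_X = Φ^tp⁻¹(kumPiX)`**. (toy bookkeeping) [cite: MochizukiEtTh2009, Def 2.5 p.39] -/
theorem tp_PiX : (PiXK l).comap (toHatK l).toMonoidHom = (kumPiX l).comap (PhiG l) :=
  comap_toHatK_comap_PhiK l _

omit [NeZero l] in
/-- **`tp D_x = Φ^tp⁻¹⟨c, g⟩`**. (toy bookkeeping) [cite: MochizukiEtTh2009, Cor 2.9 p.43] -/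
theorem tp_Dx : (DxK l).comap (toHatK l).toMonoidHom = (kumDx l).comap (PhiG l) :=
  comap_toHatK_comap_PhiK l _

/-! ## 4. The cusp stabiliser `N_{Π^tp_C}(tp D_x) = Π^tp_{C̲}` -/

omit [NeZero l] in
/-- **The cusp stabiliser of the model**: `N_{Π^tp_C}(Φ^tp⁻¹⟨c, g⟩) = Φ^tp⁻¹((ℤ/l)³ ⋊ {1, s r}) = Π^tp_{C̲}` (pull back the toy's
`N(D_x) = Π_{C̲}-part` along the surjection `Φ^tp`). It CONTAINS the inversion `ι̲ = s r ∉ Π^tp_X` and meets `Π^tp_X` in `Π^tp_{X̲}`.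
(toy bookkeeping) [cite: MochizukiEtTh2009, Cor 2.9 p.43] -/
theorem normalizer_tpDx :
    Subgroup.normalizer (((kumDx l).comap (PhiG l) : Subgroup (GtpK l)) : Set (GtpK l)) = (kumHp l).comap (PhiG l) := by
  rw [← Subgroup.comap_normalizer_eq_of_surjective _ (PhiG_surjective l), normalizer_kumDx]

/-! ## 5. `⁅Δ_X, Δ_X⁆ · Ker = Δ̄_Θ-preimage` (the centre is generated by commutators) -/

omit [NeZero l] in
/-- **`hΘ` holds in the Kummer-twist model**: `⁅Δ_X, Δ_X⁆ ⊔ Ker Φ = Φ⁻¹(centre)` (`l` odd: every `(0, y, 0)` is the single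
commutator `[r, (y/2, 0, 0)]`). (toy bookkeeping) [cite: MochizukiEtTh2009, Def 2.1 p.36] -/
theorem commutator_sup_barKer (hl : Odd l) :
    ⁅PiXK l ⊓ (augK l).ker, PiXK l ⊓ (augK l).ker⁆ ⊔ barKerK l = barThetaK l := by
  refine le_antisymm (sup_le ?_ (barKerK_le_comap l _)) fun x hx => ?_
  · -- `⁅Δ_X, Δ_X⁆ ⊆ Φ⁻¹(centre)`
    rw [deltaK_eq, Subgroup.commutator_le]
    intro a ha b hb
    change PhiK l (a * b * a⁻¹ * b⁻¹) ∈ kumZ l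
    rw [map_mul, map_mul, map_mul, map_inv, map_inv]
    exact commutator_mem_kumZ l ha hb
  · -- `Φ⁻¹(centre) ⊆ ⁅Δ_X, Δ_X⁆ · Ker Φ`
    have h2 : ∃ h : ZMod l, 2 * h = 1 := by
      obtain ⟨k, hk⟩ := hl
      refine ⟨(k : ZMod l) + 1, ?_⟩
      have h0 : ((2 * k + 1 : ℕ) : ZMod l) = 0 := by rw [← hk]; exact ZMod.natCast_self l
      have h1 : (2 : ZMod l) * k + 1 = 0 := by exact_mod_cast h0
      linear_combination h1
    have hx' : PhiK l x ∈ kumZ l := hx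
    obtain ⟨b, hb, hcomm⟩ := mk_y_eq_commutator l h2 (υ l (PhiK l x))
    -- lifts of `r` and `b` to `Δ_X ⊆ Π_C`
    let R : PiCK l := (TK.inK l (SemidirectProduct.inr (DihedralGroup.r 1)) 1, 1)
    let B : PiCK l := (TK.inK l b 1, 1)
    have hR : R ∈ PiXK l ⊓ (augK l).ker := by rw [deltaK_eq]; exact inr_r_mem_delta l 1
    have hB : B ∈ PiXK l ⊓ (augK l).ker := by rw [deltaK_eq]; exact hb
    have hκ : R * B * R⁻¹ * B⁻¹ ∈ ⁅PiXK l ⊓ (augK l).ker, PiXK l ⊓ (augK l).ker⁆ :=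
      Subgroup.commutator_mem_commutator hR hB
    have hΦ : PhiK l (R * B * R⁻¹ * B⁻¹) = PhiK l x := by
      rw [map_mul, map_mul, map_mul, map_inv, map_inv, eq_mk_of_mem_kumZ l hx', hcomm]
      rfl
    have hrest : (R * B * R⁻¹ * B⁻¹)⁻¹ * x ∈ barKerK l := by
      change PhiK l ((R * B * R⁻¹ * B⁻¹)⁻¹ * x) = 1
      rw [map_mul, map_inv, hΦ, inv_mul_cancel]
    have : x = (R * B * R⁻¹ * B⁻¹) * ((R * B * R⁻¹ * B⁻¹)⁻¹ * x) := by rw [mul_inv_cancel_left]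
    rw [this]
    exact Subgroup.mul_mem _ (Subgroup.mem_sup_left hκ) (Subgroup.mem_sup_right hrest)

end KummerModel

end ThetaCovers

end Literature.AnabelianGeometry.EtaleTheta
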